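import Literature.ModelTheory.ExponentialFields.DefinitionalExpansion
import Literature.ModelTheory.ExponentialFields.RealExpModels
import Mathlib.ModelTheory.Order
import HarnessLib

/-!
# The restricted exponential `exp↾[0,1]`: the theory `T_{exp↾} = Th(ℝ; +, ·, -, 0, 1, exp↾[0,1], ≤)` and the reducts of the models of `T_exp`

Topic `Literature/ModelTheory/ExponentialFields`.  Wilkie's **First Main Theorem** (A. J. Wilkie,
J. Amer. Math. Soc. 9 (1996), 1051–1094) states the model completeness of expansions of the real
ordered field by *restricted* Pfaffian functions — functions truncated to the closed unit box
and `0` outside; its Example (A) (p. 1053) is the restricted exponential `exp↾[0, 1]`.  M. den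
Besten, *Wilkie's Theorem and the Uniform Real Schanuel Conjecture* (MSc thesis, Utrecht 2016),
Definitions 1.2.1–1.2.2, calls the resulting language and complete theory `L_{Pf↾}` and
`T_{Pf↾} = Th(ℝ | L_{Pf↾})` (Theorem 2.1.1: "`T_{Pf↾}` is model complete"), and for the chain
consisting of `exp` alone writes `L_{exp↾}`, `T_{exp↾}` (Lemma 6.2.3, Corollary 6.2.4: the
models of `T_e` and `T_{exp↾}` have the same definable sets, whence `T_e` is model complete).

This file sets up `exp↾[0, 1]` exactly as `ETheory.lean` sets up `e`:

* `Language.rexpUnary` (one unary symbol `rexp`), **`Language.orderedRexpRing = L_{exp↾}`**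
  (ordered), `Language.orderedExpRexpRing = L_exp ∪ {exp↾}`; the class `RexpFun` with the
  instances `exp↾[0,1](x) = exp x` for `0 ≤ x ≤ 1` and `= 0` otherwise, on `ℝ` and on every model
  `K` of `T_exp` (`Real.rexp_def`, `RealExpModel.rexp_def`);
* `rexpDefs`: the *quantifier-free* `L_exp`-definition of `exp↾[0,1]`, `IsDefinedBy` for `ℝ` and
  `K` (`rexpDefs_isDefinedBy_real`, `RealExpModel.rexpDefs_isDefinedBy`);
* **`rexpTheory = T_{exp↾} := Th(ℝ | L_{exp↾})`**, complete, and `K ⊨ T_{exp↾}` for every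
  `K ⊨ T_exp` (`RealExpModel.model_rexpTheory`), transfer (`realize_rSentence_iff_real`), the
  bundled reduct `RealExpModel.rexpModel K`;
* `RealExpModel.definable_of_definable_orderedRexpRing`, `RealExpModel.rexpEmbedding`.

So the First Main Theorem for `exp↾[0,1]` is the statement `rexpTheory.IsModelComplete`
(den Besten, Theorem 2.1.1 for the chain `exp`); it is NOT asserted here (no named fact).

## References

* A. J. Wilkie, *Model completeness results for expansions of the ordered field of real numbers
  by restricted Pfaffian functions and the exponential function*, J. Amer. Math. Soc. 9 (1996):
  First Main Theorem; Example (A), p. 1053. [WilkieJAMS1996]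
* M. den Besten, *Wilkie's Theorem and the Uniform Real Schanuel Conjecture*, MSc thesis,
  Utrecht 2016: Definitions 1.2.1–1.2.2, Theorem 2.1.1, Lemma 6.2.3, Corollary 6.2.4. [DenBesten2016]
-/

noncomputable section

open FirstOrder FirstOrder.Language FirstOrder.Language.Structure
open scoped FirstOrder

namespace Literature.ModelTheory.ExponentialFields

universe w

/-! ### The languages `{exp↾}`, `L_{exp↾}` and `L_exp ∪ {exp↾}` -/

/-- The function symbols of the one-symbol language `{exp↾}`: a single unary symbol for the
restricted exponential `exp↾[0,1]` (den Besten 2016, Definition 1.2.2, the case of the Pfaffian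
chain `exp`). [cite: DenBesten2016, Definition 1.2.2] -/
inductive rexpFunc : ℕ → Type
  | rexp : rexpFunc 1
  deriving DecidableEq

/-- The language `{exp↾}` with one unary function symbol and no relation symbols.
[cite: DenBesten2016, Definition 1.2.2] -/
abbrev Language.rexpUnary : Language :=
  { Functions := rexpFunc
    Relations := fun _ => Empty }

/-- `{exp↾}` has no relation symbols. [folklore] -/
instance Language.rexpUnary.instIsAlgebraic : Language.rexpUnary.IsAlgebraic :=
  fun _ => inferInstanceAs (IsEmpty Empty)

/-- **The language `L_{exp↾} = {+, ·, -, 0, 1, ≤} ∪ {exp↾[0,1]}`** (den Besten 2016,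
Definition 1.2.2; Wilkie 1996, Example (A), p. 1053). [cite: DenBesten2016, Definition 1.2.2] -/
abbrev Language.orderedRexpRing : Language :=
  Language.orderedRing.sum Language.rexpUnary

/-- The language `L_exp ∪ {exp↾} = {+, ·, -, 0, 1, exp, ≤} ∪ {exp↾[0,1]}`, in which `exp↾` is
explicitly (quantifier-free) definable from `exp`. [cite: DenBesten2016, Lemma 6.2.3] -/
abbrev Language.orderedExpRexpRing : Language :=
  Language.orderedExpRing.sum Language.rexpUnary

/-- `≤` is the order symbol of `L_{exp↾}`. [folklore] -/
instance Language.orderedRexpRing.instIsOrdered : Language.orderedRexpRing.IsOrdered :=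
  ⟨Sum.inl Language.orderRel.le⟩

/-- The inclusion `L_{exp↾} → L_exp ∪ {exp↾}`. [folklore] -/
abbrev orderedRexpRingHom : Language.orderedRexpRing →ᴸ Language.orderedExpRexpRing :=
  orderedRingHomOrderedExpRing.sumMap (LHom.id Language.rexpUnary)

/-! ### Interpreting `exp↾[0,1]` -/

/-- A carrier with a distinguished unary function `rexp` (the intended interpretation being the
restricted exponential `exp↾[0,1]`). [cite: WilkieJAMS1996, Example (A) p. 1053] -/
class RexpFun (M : Type*) where
  /-- the function interpreting the symbol `exp↾` -/
  rexp : M → M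

/-- Any type with a `RexpFun` is a structure for the language `{exp↾}`. [folklore] -/
instance Language.rexpUnary.instStructure {M : Type*} [RexpFun M] :
    Language.rexpUnary.Structure M where
  funMap := fun {n} f v =>
    match n, f with
    | _, rexpFunc.rexp => RexpFun.rexp (v 0)
  RelMap := fun {n} r _ => by cases n <;> exact r.elim

/-- The symbol `exp↾` is interpreted by `RexpFun.rexp`. [folklore] -/
@[simp]
theorem Language.rexpUnary.funMap_rexp {M : Type*} [RexpFun M] (v : Fin 1 → M) :
    funMap (L := Language.rexpUnary) rexpFunc.rexp v = RexpFun.rexp (v 0) :=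
  rfl

/-- In `L_{exp↾}` (and in `L_exp ∪ {exp↾}`), the symbol `exp↾` is interpreted by `RexpFun.rexp`.
[folklore] -/
@[simp]
theorem Language.orderedRexpRing.funMap_rexp {L : Language} {M : Type*} [L.Structure M]
    [RexpFun M] (v : Fin 1 → M) :
    funMap (L := L.sum Language.rexpUnary)
      (Sum.inr rexpFunc.rexp : (L.sum Language.rexpUnary).Functions 1) v = RexpFun.rexp (v 0) :=
  rfl

/-- **`exp↾[0,1]` on `ℝ`**: `exp x` for `0 ≤ x ≤ 1`, and `0` otherwise (Wilkie 1996, Example (A),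
p. 1053; den Besten 2016, Definition 1.2.2: "the corresponding truncations").
[cite: WilkieJAMS1996, Example (A) p. 1053] -/
instance Real.instRexpFun : RexpFun ℝ :=
  ⟨fun x => if 0 ≤ x ∧ x ≤ 1 then Real.exp x else 0⟩

/-- Unfolding `exp↾[0,1]` on `ℝ`. [cite: WilkieJAMS1996, Example (A) p. 1053] -/
theorem Real.rexp_def (x : ℝ) : RexpFun.rexp x = if 0 ≤ x ∧ x ≤ 1 then Real.exp x else 0 :=
  rfl

/-- **`exp↾[0,1]` on a model `K` of `T_exp`**: `exp x` for `0 ≤ x ≤ 1`, `0` otherwise.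
[cite: DenBesten2016, Lemma 6.2.3] -/
instance RealExpModel.instRexpFun (K : Language.Theory.ModelType.{0, 0, w} realExpTheory) :
    RexpFun K :=
  ⟨fun x => if 0 ≤ x ∧ x ≤ 1 then RealExpModel.exp x else 0⟩

/-- Unfolding `exp↾[0,1]` on a model of `T_exp`. [cite: DenBesten2016, Lemma 6.2.3] -/
theorem RealExpModel.rexp_def {K : Language.Theory.ModelType.{0, 0, w} realExpTheory} (x : K) :
    RexpFun.rexp x = if 0 ≤ x ∧ x ≤ 1 then RealExpModel.exp x else 0 :=
  rfl

/-! ### `L_{exp↾}`-structures are ordered structures -/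

section Ordered

variable {M : Type*} [Add M] [Mul M] [Neg M] [Zero M] [One M] [LE M] [RexpFun M]

/-- Interpretation of `≤` in `L_{exp↾}`. [folklore] -/
@[simp]
theorem Language.orderedRexpRing.relMap_le (v : Fin 2 → M) :
    RelMap (L := Language.orderedRexpRing)
      (Sum.inl Language.orderRel.le : Language.orderedRexpRing.Relations 2) v ↔ v 0 ≤ v 1 :=
  Iff.rfl

/-- An `L_{exp↾}`-structure given by its operations, order and `exp↾` is an ordered structure in
Mathlib's sense. [folklore] -/
instance Language.orderedRexpRing.instOrderedStructure :
    Language.orderedRexpRing.OrderedStructure M :=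
  ⟨fun v => Language.orderedRexpRing.relMap_le v⟩

end Ordered

/-! ### The explicit (quantifier-free) definition of `exp↾[0,1]` in `L_exp` -/

/-- The quantifier-free `L_exp`-formula
`((0 ≤ x ∧ x ≤ 1) ∧ y = exp x) ∨ ((¬ 0 ≤ x ∨ ¬ x ≤ 1) ∧ y = 0)` in the variables `(y, x)`
defining the graph of `exp↾[0,1]` (den Besten 2016, proof of Lemma 6.2.3).
[cite: DenBesten2016, Lemma 6.2.3] -/
def rexpGraphFormula : Language.orderedExpRing.Formula (Fin 2) :=
  let x : Language.orderedExpRing.Term (Fin 2 ⊕ Fin 0) := var (Sum.inl 1)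
  let y : Language.orderedExpRing.Term (Fin 2 ⊕ Fin 0) := var (Sum.inl 0)
  (((Term.le 0 x) ⊓ (Term.le x 1)) ⊓ Term.bdEqual y (Language.orderedExpRing.termExp x)) ⊔
    ((∼(Term.le 0 x) ⊔ ∼(Term.le x 1)) ⊓ Term.bdEqual y 0)

/-- **The definition of `{exp↾}` in `L_exp`**: `exp↾` by `rexpGraphFormula` (no relation
symbols). [cite: DenBesten2016, Lemma 6.2.3] -/
def rexpDefs : Definitions Language.orderedExpRing Language.rexpUnary where
  δ := fun {k} g =>
    match k, g with
    | _, rexpFunc.rexp => rexpGraphFormula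
  ρ := fun r => r.elim

/-- The case distinction behind the definition of `exp↾[0,1]`. [folklore] -/
theorem rexpGraph_iff {F : Type*} [LE F] [Zero F] [One F] (E : F → F) (a y : F)
    [Decidable (0 ≤ a ∧ a ≤ 1)] :
    (((0 ≤ a ∧ a ≤ 1) ∧ y = E a) ∨ ((¬ 0 ≤ a ∨ ¬ a ≤ 1) ∧ y = 0)) ↔
      (if 0 ≤ a ∧ a ≤ 1 then E a else 0) = y := by
  by_cases h : 0 ≤ a ∧ a ≤ 1
  · rw [if_pos h]
    constructor
    · rintro (⟨-, rfl⟩ | ⟨h', rfl⟩)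
      · rfl
      · exact h'.elim (fun h0 => (h0 h.1).elim) fun h2 => (h2 h.2).elim
    · rintro rfl
      exact Or.inl ⟨h, rfl⟩
  · rw [if_neg h]
    constructor
    · rintro (⟨h', rfl⟩ | ⟨-, rfl⟩)
      · exact absurd h' h
      · rfl
    · rintro rfl
      exact Or.inr ⟨not_and_or.1 h, rfl⟩

/-- **`ℝ` with `exp↾[0,1]` is the definitional expansion of `ℝ_exp` along `rexpDefs`.**
[cite: DenBesten2016, Lemma 6.2.3] -/
theorem rexpDefs_isDefinedBy_real : rexpDefs.IsDefinedBy ℝ where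
  realize_δ_iff := by
    intro k g x y
    cases g
    simp only [rexpDefs, rexpGraphFormula, Formula.Realize, BoundedFormula.realize_sup,
      BoundedFormula.realize_inf, BoundedFormula.realize_not, Term.realize_le,
      BoundedFormula.realize_bdEqual, Language.orderedExpRing.realize_zero,
      Language.orderedExpRing.realize_one, Term.realize_var, Sum.elim_inl, Fin.cons_one,
      Fin.cons_zero, Language.orderedExpRing.realize_exp, Language.rexpUnary.funMap_rexp,
      Real.rexp_def]
    exact rexpGraph_iff _ _ _
  realize_ρ_iff := by
    intro k r
    exact r.elim

namespace RealExpModel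

variable (K : Language.Theory.ModelType.{0, 0, w} realExpTheory)

/-- **A model `K` of `T_exp` with `exp↾[0,1]` is the definitional expansion of `K` along
`rexpDefs`.** [cite: DenBesten2016, Lemma 6.2.3] -/
theorem rexpDefs_isDefinedBy : rexpDefs.IsDefinedBy K where
  realize_δ_iff := by
    intro k g x y
    cases g
    simp only [rexpDefs, rexpGraphFormula, Formula.Realize, BoundedFormula.realize_sup,
      BoundedFormula.realize_inf, BoundedFormula.realize_not, Term.realize_le,
      BoundedFormula.realize_bdEqual, realize_zero, realize_one, Term.realize_var, Sum.elim_inl,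
      Fin.cons_one, Fin.cons_zero, realize_termExp, Language.rexpUnary.funMap_rexp, rexp_def]
    exact rexpGraph_iff _ _ _
  realize_ρ_iff := by
    intro k r
    exact r.elim

end RealExpModel

/-! ### The theory `T_{exp↾}` -/

/-- **`T_{exp↾} = Th(ℝ | L_{exp↾})`**, the complete theory of `(ℝ; +, ·, -, 0, 1, ≤, exp↾[0,1])`
(den Besten 2016, Definition 1.2.2 for the chain `exp`; Wilkie 1996, `T̃'` for Example (A)).
Wilkie's First Main Theorem for `exp↾[0,1]` (den Besten, Theorem 2.1.1) is the statement
`rexpTheory.IsModelComplete`. [cite: DenBesten2016, Definition 1.2.2] -/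
def rexpTheory : Language.orderedRexpRing.Theory :=
  Language.orderedRexpRing.completeTheory ℝ

/-- `ℝ` is a model of `T_{exp↾}` (tautologically). [folklore] -/
instance Real.model_rexpTheory : ℝ ⊨ rexpTheory :=
  Language.model_completeTheory

/-- `T_{exp↾}` is complete (it is the complete theory of a structure). [folklore] -/
theorem rexpTheory_isComplete : rexpTheory.IsComplete :=
  Language.completeTheory.isComplete _ _

namespace RealExpModel

/-- Every model of `T_exp`, with `exp↾[0,1]`, satisfies `Th(ℝ; exp, exp↾)` (definitional
expansions of elementarily equivalent structures). [cite: DenBesten2016, Lemma 6.2.3] -/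
theorem model_orderedExpRexpRing_completeTheory
    (K : Language.Theory.ModelType.{0, 0, 0} realExpTheory) :
    (K : Type) ⊨ Language.orderedExpRexpRing.completeTheory ℝ :=
  (rexpDefs_isDefinedBy K).models_completeTheory_sum rexpDefs_isDefinedBy_real
    (show (K : Type) ⊨ Language.orderedExpRing.completeTheory ℝ from K.is_model)

/-- **Every model `K` of `T_exp` is a model of `T_{exp↾}`** with `exp↾ = exp` on `[0, 1]` and
`0` elsewhere (den Besten 2016, proof of Lemma 6.2.3). [cite: DenBesten2016, Lemma 6.2.3] -/
instance model_rexpTheory (K : Language.Theory.ModelType.{0, 0, 0} realExpTheory) :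
    (K : Type) ⊨ rexpTheory := by
  refine ⟨fun σ hσ => ?_⟩
  have hR : ℝ ⊨ orderedRexpRingHom.onSentence σ :=
    (LHom.realize_onSentence ℝ orderedRexpRingHom σ).2 (Language.mem_completeTheory.1 hσ)
  have hK : (K : Type) ⊨ orderedRexpRingHom.onSentence σ :=
    (model_orderedExpRexpRing_completeTheory K).realize_of_mem _
      (Language.mem_completeTheory.2 hR)
  exact (LHom.realize_onSentence K orderedRexpRingHom σ).1 hK

/-- **Transfer principle for `L_{exp↾}`-sentences**: an `L_{exp↾}`-sentence holds in a model of
`T_exp` iff it holds in `ℝ`. [cite: DenBesten2016, Definition 1.2.2] -/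
theorem realize_rSentence_iff_real (K : Language.Theory.ModelType.{0, 0, 0} realExpTheory)
    (σ : Language.orderedRexpRing.Sentence) : (K : Type) ⊨ σ ↔ ℝ ⊨ σ := by
  constructor
  · intro h
    by_contra hR
    have h' : ℝ ⊨ σ.not := hR
    exact ((model_rexpTheory K).realize_of_mem _ (Language.mem_completeTheory.2 h')) h
  · intro h
    exact (model_rexpTheory K).realize_of_mem _ (Language.mem_completeTheory.2 h)

/-- The `exp↾`-reduct `K | L_{exp↾}` of a model of `T_exp`, bundled as a model of `T_{exp↾}`.
[cite: DenBesten2016, Lemma 6.2.3] -/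
abbrev rexpModel (K : Language.Theory.ModelType.{0, 0, 0} realExpTheory) :
    Language.Theory.ModelType.{0, 0, 0} rexpTheory :=
  ⟨K⟩

/-! ### `L_{exp↾}`-definable sets are `L_exp`-definable -/

variable (K : Language.Theory.ModelType.{0, 0, w} realExpTheory)

/-- Every subset of `Kⁿ` definable in `K | L_{exp↾}` (parameters `A`) is definable in the
`L_exp`-structure `K` with the same parameters. [cite: DenBesten2016, Lemma 6.2.3] -/
theorem definable_of_definable_orderedRexpRing {A : Set K} {α : Type*} {s : Set (α → K)}
    (h : A.Definable Language.orderedRexpRing s) : A.Definable Language.orderedExpRing s :=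
  (rexpDefs_isDefinedBy K).definable_of_definable_sum (h.map_expansion orderedRexpRingHom)

end RealExpModel

/-- Every subset of `ℝⁿ` definable in `(ℝ; +, ·, ≤, exp↾)` is definable in `ℝ_exp` (same
parameters). [cite: DenBesten2016, Lemma 6.2.3] -/
theorem Real.definable_of_definable_orderedRexpRing {A : Set ℝ} {α : Type*} {s : Set (α → ℝ)}
    (h : A.Definable Language.orderedRexpRing s) : A.Definable Language.orderedExpRing s :=
  rexpDefs_isDefinedBy_real.definable_of_definable_sum (h.map_expansion orderedRexpRingHom)

/-! ### Embeddings of models of `T_exp` are `L_{exp↾}`-embeddings -/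

namespace RealExpModel

variable {k K : Language.Theory.ModelType.{0, 0, w} realExpTheory}
  (f : k ↪[Language.orderedExpRing] K)

/-- **Embeddings of models of `T_exp` commute with `exp↾[0,1]`**. [cite: DenBesten2016, Lemma 6.2.3] -/
@[simp]
theorem map_rexp (a : k) : f (RexpFun.rexp a) = RexpFun.rexp (f a) := by
  rw [rexp_def, rexp_def]
  have h0 : (0 : k) ≤ a ↔ (0 : K) ≤ f a := by rw [← map_le_iff f 0 a, map_zero]
  have h1 : a ≤ 1 ↔ f a ≤ 1 := by rw [← map_le_iff f a 1, map_one]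
  by_cases h : 0 ≤ a ∧ a ≤ 1
  · rw [if_pos h, if_pos ⟨h0.1 h.1, h1.1 h.2⟩, map_exp]
  · have h' : ¬ (0 ≤ f a ∧ f a ≤ 1) := fun hf => h ⟨h0.2 hf.1, h1.2 hf.2⟩
    rw [if_neg h, if_neg h', map_zero]

/-- **An embedding `f : k ↪ K` of models of `T_exp` as an embedding of `L_{exp↾}`-structures**
(same underlying map). [cite: DenBesten2016, Lemma 6.2.3] -/
def rexpEmbedding : k ↪[Language.orderedRexpRing] K where
  toFun := f
  inj' := f.injective
  map_fun' := by
    intro n g x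
    rcases g with g | g
    · cases g
      · exact map_add f (x 0) (x 1)
      · exact map_mul f (x 0) (x 1)
      · exact map_neg f (x 0)
      · exact map_zero f
      · exact map_one f
    · cases g
      rw [Language.orderedRexpRing.funMap_rexp, Language.orderedRexpRing.funMap_rexp]
      exact map_rexp f (x 0)
  map_rel' := by
    intro n r x
    rcases r with r | r
    · cases r
      rw [Language.orderedRexpRing.relMap_le, Language.orderedRexpRing.relMap_le]
      exact map_le_iff f (x 0) (x 1)
    · exact r.elim

/-- The underlying map of `rexpEmbedding f` is `f`. [folklore] -/
@[simp]
theorem rexpEmbedding_apply (a : k) : rexpEmbedding f a = f a :=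
  rfl

end RealExpModel

end Literature.ModelTheory.ExponentialFields
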